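import Literature.Probability.RandomPlanarGeometry.HexSAWBridgeLogDecay
import Literature.Probability.RandomPlanarGeometry.YangBaxterSAWBridgeDecay
import Literature.Probability.RandomPlanarGeometry.YangBaxterSAWHexBridges
import HarnessLib

/-!
# Glazman–Manolescu, Proposition 1.1, eq. (3) AS PRINTED: `Σ_{T ≥ 1} (1/T)·B_T(π/3)³ < ∞` — proved

Topic `Literature/Probability/RandomPlanarGeometry`. Source: A. Glazman, I. Manolescu, *Self-avoiding walk on
`ℤ²` with Yang–Baxter weights: universality of critical fugacity and 2-point function*, Ann. Inst. Henri
Poincaré Probab. Stat. 56 (2020) 2281–2300 = arXiv:1708.00395 (held `paper:arxiv-1708.00395`), **Proposition 1.1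
(p. 4 = p0004:L27–L36): "We have `Σ_{T ≥ 1} (1/T)·(B_T(π/3))³ < ∞`. (3) As a consequence, the partition function
of self-avoiding bridges on the hexagonal lattice vanishes at infinity: `B_T(π/3) → 0` as `T → ∞`. Moreover
`B_T(π/3) < 1/(log T)^{1/3}` for infinitely many values of `T`"**, proof §4.1 (p0010–p0011: Lemma 4.1
"`B_{2L+1} ≤ cos(π/8)·D^Δ_{2L+1}`", the key inequality `(D^Δ_{4L})³ ≤ Σ_{K=L}^{9L} G_T(0,K)` and "Summing the
above over `L = 9^k` we find `Σ_k (D^Δ_{4·9^k})³ ≤ 8 Σ_k G(0,k) < ∞`").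

State of the tree before this file: the printed CONSEQUENCES of (3) are proved (`HV.tendsto_stripBlim`,
`YangBaxter.GlazmanManolescu2019_prop11_limit_holds`; the all-`T` logarithmic rate `hexBridgeLogDecay`), and the
two printed deductions FROM (3) are proved with (3) as a HYPOTHESIS `h3`
(`YangBaxter.GlazmanManolescu2019_prop11_limit_of_cube`, `YangBaxter.GlazmanManolescu2019_prop11_logBound_of_cube`,
`YangBaxterSAWBridgeDecay.lean`); eq. (3) itself was not in the tree. This file PROVES (3), by the printed route:

* `HV.sum_triDl_pow_three_le` — the SUMMED block inequality `Σ_{i ≤ m} triDl(4·10^i)³ ≤ 1/cos(3π/8)` for every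
  `m` (the printed "`Σ_k (D^Δ_{4·9^k})³ ≤ 8 Σ_k G(0,k) < ∞`", with the tree's blocks `10^i` in one strip
  `S_{8·10^m+1, 9·10^m+1}` and `A_{T',L''} ≤ 1/cos(3π/8)` from Duminil-Copin–Smirnov's Lemma 2; the tree's
  `HV.triDl_pow_three_le` is the pointwise corollary `(m+1)·triDl(4·10^m)³ ≤ 1/cos(3π/8)` of the same chain);
* `HV.sum_stripBlim_cube_div_le` — the partial sums `Σ_{t < n} B_t(x_c)³/t ≤ 9 + 72cos³(π/8)/cos(3π/8)` for every
  `n`, grouping `t` into the blocks `8·10^i < t ≤ 8·10^{i+1}` on which `B_t ≤ 2cos(π/8)·triDl(4·10^i)`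
  (monotonicity `stripBlim_antitone'` + `stripBlim_le_two_mul_triDl`, as in `hexBridgeLogDecayBlocks`) and
  `#block · (1/min t) = 9`;
* **`HV.summable_stripBlim_cube_div`** — eq. (3) in Duminil-Copin–Smirnov's encoding: `Σ_T B_T(x_c)³/T`
  converges (`B_T(x_c) = HV.stripBlim T`, the bridge partition function of the strip of `T` rows of hexagons);
* `YangBaxter.bridgePartitionFunction_pi_div_three_le_stripBlim` — `B_T(π/3) ≤ B_T(x_c)` (the injection
  `YangBaxter.sum_weight_le_stripB` of the tree, "the self-avoiding walk model [on `H(π/3)`] becomes that on the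
  hexagonal lattice", §1 p. 3);
* **`YangBaxter.GlazmanManolescu2019_eq3`** — eq. (3) AS PRINTED, in the Yang–Baxter encoding of
  `YangBaxterSAW.lean`: `Σ_{T ≥ 1} B_T(π/3)³/T < ∞` (the exact hypothesis `h3` of the two `_of_cube` theorems);
* **`YangBaxter.GlazmanManolescu2019_prop11_logBound`** — the last clause of Proposition 1.1 AS PRINTED, now
  unconditional: "`B_T(π/3) < 1/(log T)^{1/3}` for infinitely many values of `T`"; and the same clause in DCS's
  encoding, `HV.stripBlim_lt_log_rpow_frequently` (constant `1`; from eq. (3), not from the all-`T` bound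
  `hexBridgeLogDecay` whose constant is `5`).

No named facts are introduced; `GlazmanManolescu2019_prop11` (the cube-less mis-quote in `YangBaxterSAWFacts.lean`)
is NOT touched (it is strictly stronger than (3) and needs a polynomial rate).
-/

noncomputable section

open Real Finset Filter Topology Literature.Probability.LatticeModels Literature.Probability.Percolation
open scoped ENNReal

namespace Literature.Probability.RandomPlanarGeometry.SAW

namespace HV

/-! ### The summed block inequality -/

/-- **"Summing the above over `L = 9^k` we find `Σ_k (D^Δ_{4·9^k})³ ≤ 8 Σ_k G(0,k) < ∞`"** — here with the
blocks `L = 10^i`, `i ≤ m`, inside the single strip `S_{8·10^m+1, 9·10^m+1}`: the arcs exiting in the disjoint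
column ranges `[-9·10^i-1, -10^i-1]` have total weight at most `A_{T',L''}(x_c) ≤ 1/cos(3π/8)` (DCS Lemma 2).
[cite: GlazmanManolescu2019, §4.1 (proof of Proposition 1.1)] -/
theorem sum_triDl_pow_three_le (m : ℕ) :
    ∑ i ∈ range (m + 1), triDl (4 * 10 ^ i) ^ 3 ≤ (Real.cos (3 * Real.pi / 8))⁻¹ := by
  set T' := 8 * 10 ^ m + 1 with hT'
  set L'' := 9 * 10 ^ m + 1 with hL''
  have h0 : 0 ≤ hexCriticalFugacity := hexCriticalFugacity_pos_lt_one.1.le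
  have hblock : ∀ i ∈ range (m + 1), triDl (4 * 10 ^ i) ^ 3 ≤
      ∑ Q ∈ arcsIn T' L'' (10 ^ i), hexCriticalFugacity ^ mwLen Q := by
    intro i hi
    rw [mem_range] at hi
    have hpow : 10 ^ i ≤ 10 ^ m := Nat.pow_le_pow_right (by norm_num) (by omega)
    exact key_ineq (10 ^ i) (by rw [hT']; omega) (by rw [hL'']; omega)
  calc ∑ i ∈ range (m + 1), triDl (4 * 10 ^ i) ^ 3
      ≤ ∑ i ∈ range (m + 1), ∑ Q ∈ arcsIn T' L'' (10 ^ i), hexCriticalFugacity ^ mwLen Q :=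
        sum_le_sum hblock
    _ = ∑ Q ∈ (range (m + 1)).biUnion (fun i => arcsIn T' L'' (10 ^ i)),
          hexCriticalFugacity ^ mwLen Q := by
        rw [sum_biUnion]
        intro i _ j _ hij
        exact disjoint_arcsIn T' L'' hij
    _ ≤ stripA T' L'' hexCriticalFugacity := by
        unfold stripA
        apply sum_le_sum_of_subset_of_nonneg
        · intro Q hQ
          rw [mem_biUnion] at hQ
          obtain ⟨i, -, hQ⟩ := hQ
          rw [arcsIn, mem_filter] at hQ
          rw [mem_filter]
          exact ⟨hQ.1, hQ.2.1⟩
        · exact fun _ _ _ => pow_nonneg h0 _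
    _ ≤ (Real.cos (3 * Real.pi / 8))⁻¹ :=
        stripA_le_of_lemma2 DuminilCopinSmirnov2012_lemma2_holds (by rw [hT']; omega) L''

/-! ### The partial sums of `Σ_T B_T(x_c)³/T` -/

/-- Each term `B_t(x_c)³/t` is at most `1` (`B_t ≤ 1`, DCS eq. (4); the `t = 0` term is `0`).
[cite: GlazmanManolescu2019, §4.1 (proof of Proposition 1.1); DuminilCopinSmirnov2012, §3 eq. (4)] -/
theorem stripBlim_pow_three_div_le_one (t : ℕ) : stripBlim t ^ 3 / t ≤ 1 := by
  rcases Nat.eq_zero_or_pos t with rfl | ht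
  · simp
  · have h1 : stripBlim t ≤ 1 := stripBlim_le_one ht
    have h0 : 0 ≤ stripBlim t := stripBlim_nonneg ht
    have ht1 : (1 : ℝ) ≤ t := by exact_mod_cast ht
    rw [div_le_one (by positivity)]
    calc stripBlim t ^ 3 ≤ 1 ^ 3 := pow_le_pow_left₀ h0 h1 3
      _ = 1 := one_pow 3
      _ ≤ t := ht1

/-- The terms are nonnegative. [cite: DuminilCopinSmirnov2012, §3] -/
theorem stripBlim_pow_three_div_nonneg (t : ℕ) : 0 ≤ stripBlim t ^ 3 / t := by
  rcases Nat.eq_zero_or_pos t with rfl | ht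
  · simp
  · exact div_nonneg (pow_nonneg (stripBlim_nonneg ht) 3) (Nat.cast_nonneg t)

/-- On the block `8·10^i < t ≤ 8·10^{i+1}`: `B_t(x_c)³/t ≤ 8cos³(π/8)·triDl(4·10^i)³/(8·10^i)`
(`B_t ≤ B_{8·10^i+1} ≤ 2cos(π/8)·triDl(4·10^i)`). [cite: GlazmanManolescu2019, §4.1 (Lemma 4.1 and monotonicity)] -/
theorem stripBlim_pow_three_div_le_block {i t : ℕ} (ht : 8 * 10 ^ i + 1 ≤ t) :
    stripBlim t ^ 3 / t ≤
      (2 * Real.cos (Real.pi / 8) * triDl (4 * 10 ^ i)) ^ 3 / (8 * 10 ^ i : ℝ) := by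
  have ht0 : (0 : ℝ) < t := by exact_mod_cast (show 0 < t by omega)
  have hb : (0 : ℝ) < 8 * 10 ^ i := by positivity
  have h0 : 0 ≤ stripBlim t := stripBlim_nonneg (by omega)
  have h1 : stripBlim t ≤ 2 * Real.cos (Real.pi / 8) * triDl (4 * 10 ^ i) :=
    calc stripBlim t ≤ stripBlim (2 * (4 * 10 ^ i) + 1) := stripBlim_antitone' (by omega) (by omega)
      _ ≤ _ := stripBlim_le_two_mul_triDl _
  have h2 : stripBlim t ^ 3 ≤ (2 * Real.cos (Real.pi / 8) * triDl (4 * 10 ^ i)) ^ 3 :=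
    pow_le_pow_left₀ h0 h1 3
  have h3 : (8 * 10 ^ i : ℝ) ≤ t := by exact_mod_cast (show 8 * 10 ^ i ≤ t by omega)
  have hc : 0 ≤ (2 * Real.cos (Real.pi / 8) * triDl (4 * 10 ^ i)) ^ 3 := le_trans (pow_nonneg h0 3) h2
  calc stripBlim t ^ 3 / t ≤ (2 * Real.cos (Real.pi / 8) * triDl (4 * 10 ^ i)) ^ 3 / t :=
        div_le_div_of_nonneg_right h2 ht0.le
    _ ≤ (2 * Real.cos (Real.pi / 8) * triDl (4 * 10 ^ i)) ^ 3 / (8 * 10 ^ i : ℝ) :=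
        div_le_div_of_nonneg_left hc hb h3

/-- **The partial sums up to the end of block `m`**:
`Σ_{t ≤ 8·10^m} B_t(x_c)³/t ≤ 9 + 72cos³(π/8)·Σ_{i < m} triDl(4·10^i)³`.
[cite: GlazmanManolescu2019, §4.1 (proof of Proposition 1.1, "Summing the above")] -/
theorem sum_stripBlim_cube_div_blocks_le (m : ℕ) :
    ∑ t ∈ range (8 * 10 ^ m + 1), stripBlim t ^ 3 / t ≤
      9 + 72 * Real.cos (Real.pi / 8) ^ 3 * ∑ i ∈ range m, triDl (4 * 10 ^ i) ^ 3 := by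
  induction m with
  | zero =>
    simp only [pow_zero, mul_one, range_zero, sum_empty, mul_zero, add_zero]
    calc ∑ t ∈ range (8 + 1), stripBlim t ^ 3 / t ≤ ∑ t ∈ range (8 + 1), (1 : ℝ) :=
          sum_le_sum fun t _ => stripBlim_pow_three_div_le_one t
      _ = 9 := by simp
  | succ m ih =>
    have hsplit : ∑ t ∈ range (8 * 10 ^ (m + 1) + 1), stripBlim t ^ 3 / t =
        ∑ t ∈ range (8 * 10 ^ m + 1), stripBlim t ^ 3 / t +
          ∑ t ∈ Ico (8 * 10 ^ m + 1) (8 * 10 ^ (m + 1) + 1), stripBlim t ^ 3 / t := by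
      rw [range_eq_Ico, range_eq_Ico]
      exact (sum_Ico_consecutive _ (Nat.zero_le _)
        (by rw [pow_succ]; omega)).symm
    have hcard : (Ico (8 * 10 ^ m + 1) (8 * 10 ^ (m + 1) + 1)).card = 72 * 10 ^ m := by
      have hX : 10 ^ (m + 1) = 10 ^ m * 10 := pow_succ 10 m
      rw [Nat.card_Ico, hX]
      omega
    have hblock : ∑ t ∈ Ico (8 * 10 ^ m + 1) (8 * 10 ^ (m + 1) + 1), stripBlim t ^ 3 / t ≤
        72 * Real.cos (Real.pi / 8) ^ 3 * triDl (4 * 10 ^ m) ^ 3 := by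
      calc ∑ t ∈ Ico (8 * 10 ^ m + 1) (8 * 10 ^ (m + 1) + 1), stripBlim t ^ 3 / t
          ≤ ∑ t ∈ Ico (8 * 10 ^ m + 1) (8 * 10 ^ (m + 1) + 1),
              (2 * Real.cos (Real.pi / 8) * triDl (4 * 10 ^ m)) ^ 3 / (8 * 10 ^ m : ℝ) :=
            sum_le_sum fun t ht => stripBlim_pow_three_div_le_block (mem_Ico.1 ht).1
        _ = ((72 * 10 ^ m : ℕ) : ℝ) *
              ((2 * Real.cos (Real.pi / 8) * triDl (4 * 10 ^ m)) ^ 3 / (8 * 10 ^ m : ℝ)) := by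
            rw [sum_const, hcard, nsmul_eq_mul]
        _ = 72 * Real.cos (Real.pi / 8) ^ 3 * triDl (4 * 10 ^ m) ^ 3 := by
            have h10 : (0 : ℝ) < 10 ^ m := by positivity
            push_cast
            field_simp
            ring
    have hr : ∑ i ∈ range (m + 1), triDl (4 * 10 ^ i) ^ 3 =
        ∑ i ∈ range m, triDl (4 * 10 ^ i) ^ 3 + triDl (4 * 10 ^ m) ^ 3 := sum_range_succ _ m
    have hd := mul_add (72 * Real.cos (Real.pi / 8) ^ 3) (∑ i ∈ range m, triDl (4 * 10 ^ i) ^ 3)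
      (triDl (4 * 10 ^ m) ^ 3)
    rw [hsplit, hr, hd]
    linarith

/-- **All partial sums are bounded**: `Σ_{t < n} B_t(x_c)³/t ≤ 9 + 72cos³(π/8)/cos(3π/8)` for every `n`.
[cite: GlazmanManolescu2019, Proposition 1.1, eq. (3) (proof §4.1)] -/
theorem sum_stripBlim_cube_div_le (n : ℕ) :
    ∑ t ∈ range n, stripBlim t ^ 3 / t ≤
      9 + 72 * Real.cos (Real.pi / 8) ^ 3 * (Real.cos (3 * Real.pi / 8))⁻¹ := by
  have hn : n ≤ 8 * 10 ^ n + 1 := by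
    have : n < 10 ^ n := Nat.lt_pow_self (by norm_num)
    omega
  have hc : 0 ≤ 72 * Real.cos (Real.pi / 8) ^ 3 := by
    have := cos_pi_div_eight_pos; positivity
  calc ∑ t ∈ range n, stripBlim t ^ 3 / t ≤ ∑ t ∈ range (8 * 10 ^ n + 1), stripBlim t ^ 3 / t :=
        sum_le_sum_of_subset_of_nonneg (range_mono hn) fun t _ _ => stripBlim_pow_three_div_nonneg t
    _ ≤ 9 + 72 * Real.cos (Real.pi / 8) ^ 3 * ∑ i ∈ range n, triDl (4 * 10 ^ i) ^ 3 :=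
        sum_stripBlim_cube_div_blocks_le n
    _ ≤ 9 + 72 * Real.cos (Real.pi / 8) ^ 3 * (Real.cos (3 * Real.pi / 8))⁻¹ := by
        have hs : ∑ i ∈ range n, triDl (4 * 10 ^ i) ^ 3 ≤ (Real.cos (3 * Real.pi / 8))⁻¹ := by
          rcases Nat.eq_zero_or_pos n with rfl | hn1
          · simp only [range_zero, sum_empty]
            exact (inv_pos.2 cos_three_pi_div_eight_pos).le
          · have := sum_triDl_pow_three_le (n - 1)
            rwa [Nat.sub_add_cancel hn1] at this
        have := mul_le_mul_of_nonneg_left hs hc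
        linarith

/-- **Glazman–Manolescu, Proposition 1.1, eq. (3), in Duminil-Copin–Smirnov's encoding**: the series
`Σ_T B_T(x_c)³/T` converges, `B_T(x_c) = HV.stripBlim T` the bridge partition function of the strip of `T` rows
of hexagons at the critical fugacity. [cite: GlazmanManolescu2019, Proposition 1.1, eq. (3)] -/
theorem summable_stripBlim_cube_div : Summable fun t : ℕ => stripBlim t ^ 3 / t :=
  summable_of_sum_range_le stripBlim_pow_three_div_nonneg sum_stripBlim_cube_div_le

/-- The value of the series is at most `9 + 72cos³(π/8)/cos(3π/8)`. [cite: GlazmanManolescu2019, Proposition 1.1, eq. (3)] -/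
theorem tsum_stripBlim_cube_div_le :
    ∑' t : ℕ, stripBlim t ^ 3 / t ≤ 9 + 72 * Real.cos (Real.pi / 8) ^ 3 * (Real.cos (3 * Real.pi / 8))⁻¹ :=
  summable_stripBlim_cube_div.tsum_le_of_sum_range_le sum_stripBlim_cube_div_le

end HV

namespace YangBaxter

open MidEdge

/-! ### Eq. (3) in the Yang–Baxter encoding -/

/-- **`B_T(π/3) ≤ B_T(x_c)`** for every `T ≥ 1`: the Yang–Baxter bridges of `Strip_T(π/3)` inject, weight for
weight, into Duminil-Copin–Smirnov's bridges of the strip of `T` rows of hexagons (the tree's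
`sum_weight_le_stripB`), whose finite-volume partition functions are `≤ B_T(x_c)` (`stripB_le_lim`).
[cite: GlazmanManolescu2019, §1 p. 3 ("the self-avoiding walk model described above becomes that on the hexagonal lattice")] -/
theorem bridgePartitionFunction_pi_div_three_le_stripBlim {T : ℕ} (hT : 1 ≤ T) :
    bridgePartitionFunction T (fun _ => π / 3) ≤ ENNReal.ofReal (HV.stripBlim T) := by
  have hhex : ∀ k : ℤ, (fun _ : ℤ => π / 3) k ∈ Set.Icc (π / 3) (2 * π / 3) := fun _ => pi_div_three_mem_Icc
  unfold bridgePartitionFunction twoPoint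
  rw [← ENNReal.tsum_sigma' (β := fun jj : ℤ => YBWalk (strip T) origin (.vert T jj))
    (fun p => ENNReal.ofReal (p.2.weight fun _ => π / 3)), ENNReal.tsum_eq_iSup_sum]
  refine iSup_le fun s => ?_
  obtain ⟨L₀, hL₀⟩ := sum_weight_le_stripB hT s
  rw [← ENNReal.ofReal_sum_of_nonneg fun p _ => p.2.weight_nonneg hhex]
  exact ENNReal.ofReal_le_ofReal
    ((hL₀ L₀ le_rfl).trans (stripB_le_lim DuminilCopinSmirnov2012_lemma2_holds hT L₀))

/-- **Glazman–Manolescu, Proposition 1.1, eq. (3) AS PRINTED**: "We have `Σ_{T ≥ 1} (1/T)(B_T(π/3))³ < ∞`"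
— for the bridge partition function `B_T(π/3) = bridgePartitionFunction T (fun _ => π/3)` of the Yang–Baxter
self-avoiding walk with all angles `π/3` (the hexagonal lattice). This is exactly the hypothesis `h3` of
`GlazmanManolescu2019_prop11_limit_of_cube` / `GlazmanManolescu2019_prop11_logBound_of_cube`.
[cite: GlazmanManolescu2019, Proposition 1.1, eq. (3)] -/
theorem GlazmanManolescu2019_eq3 :
    (∑' T : ℕ, bridgePartitionFunction (T + 1) (fun _ => π / 3) ^ 3 / (T + 1 : ℝ≥0∞)) < ⊤ := by
  set f : ℕ → ℝ := fun t => HV.stripBlim t ^ 3 / t with hf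
  have hf0 : ∀ t, 0 ≤ f t := HV.stripBlim_pow_three_div_nonneg
  have hsum : Summable fun T : ℕ => f (T + 1) := (summable_nat_add_iff 1).2 HV.summable_stripBlim_cube_div
  have hle : ∀ T : ℕ, bridgePartitionFunction (T + 1) (fun _ => π / 3) ^ 3 / (T + 1 : ℝ≥0∞) ≤
      ENNReal.ofReal (f (T + 1)) := by
    intro T
    have h1 := bridgePartitionFunction_pi_div_three_le_stripBlim (T := T + 1) (by omega)
    have hs0 : 0 ≤ HV.stripBlim (T + 1) := stripBlim_nonneg (by omega)
    have hT0 : (0 : ℝ) < (T : ℝ) + 1 := by positivity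
    calc bridgePartitionFunction (T + 1) (fun _ => π / 3) ^ 3 / (T + 1 : ℝ≥0∞)
        ≤ ENNReal.ofReal (HV.stripBlim (T + 1)) ^ 3 / (T + 1 : ℝ≥0∞) := by
          gcongr
      _ = ENNReal.ofReal (f (T + 1)) := by
          rw [hf]
          dsimp only
          rw [Nat.cast_add_one, ENNReal.ofReal_div_of_pos hT0, ENNReal.ofReal_pow hs0,
            ENNReal.ofReal_add (Nat.cast_nonneg T) zero_le_one, ENNReal.ofReal_natCast, ENNReal.ofReal_one]
  calc (∑' T : ℕ, bridgePartitionFunction (T + 1) (fun _ => π / 3) ^ 3 / (T + 1 : ℝ≥0∞))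
      ≤ ∑' T : ℕ, ENNReal.ofReal (f (T + 1)) := ENNReal.tsum_le_tsum hle
    _ = ENNReal.ofReal (∑' T : ℕ, f (T + 1)) := (ENNReal.ofReal_tsum_of_nonneg (fun T => hf0 (T + 1)) hsum).symm
    _ < ⊤ := ENNReal.ofReal_lt_top

/-- **"Moreover `B_T(π/3) < 1/(log T)^{1/3}` for infinitely many values of `T`"** — the last clause of
Proposition 1.1 AS PRINTED, now unconditional (`GlazmanManolescu2019_prop11_logBound_of_cube` fed with eq. (3)).
[cite: GlazmanManolescu2019, Proposition 1.1] -/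
theorem GlazmanManolescu2019_prop11_logBound :
    ∃ᶠ T : ℕ in atTop,
      bridgePartitionFunction T (fun _ => π / 3) < ENNReal.ofReal (1 / Real.log T ^ (1 / 3 : ℝ)) :=
  GlazmanManolescu2019_prop11_logBound_of_cube GlazmanManolescu2019_eq3

end YangBaxter

namespace HV

/-! ### The printed "infinitely often" clause in Duminil-Copin–Smirnov's encoding -/

/-- **"Moreover `B_T < 1/(log T)^{1/3}` for infinitely many values of `T`"** — the last clause of
Proposition 1.1 for `B_T(x_c) = HV.stripBlim T` (DCS's bridge partition function of the strip of `T` rows of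
hexagons, `≥ B_T(π/3)` by `YangBaxter.bridgePartitionFunction_pi_div_three_le_stripBlim`), with the printed constant
`1`: otherwise `B_T³/T ≥ 1/(T log T)` for all large `T` and `Σ 1/(T log T) = ∞`, contradicting eq. (3)
(`summable_stripBlim_cube_div`). (The tree's all-`T` bound `hexBridgeLogDecay : B_T ≤ 5 (ln T)^{-1/3}` has
constant `5`; neither statement implies the other.) [cite: GlazmanManolescu2019, Proposition 1.1 (last clause; proof §4.1)] -/
theorem stripBlim_lt_log_rpow_frequently :
    ∃ᶠ T : ℕ in atTop, stripBlim T < Real.log T ^ (-(1 : ℝ) / 3) := by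
  by_contra hcon
  rw [Filter.not_frequently, eventually_atTop] at hcon
  obtain ⟨T₀, hT₀⟩ := hcon
  set T₁ : ℕ := max T₀ 2 with hT₁
  set g : ℕ → ℝ := fun T => if T₁ ≤ T then 1 / ((T : ℝ) * Real.log T) else 0 with hg
  have hg_nonneg : ∀ T, 0 ≤ g T := by
    intro T
    simp only [hg]
    split_ifs with hT
    · have hT1 : (1 : ℝ) ≤ T := by exact_mod_cast (le_of_max_le_right hT).trans' (by norm_num)
      have : (0 : ℝ) ≤ Real.log T := Real.log_nonneg hT1
      positivity
    · exact le_rfl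
  -- `g` is not summable (it agrees with `1/(T log T)` eventually)
  have hg_ns : ¬Summable g := by
    intro hs
    refine YangBaxter.not_summable_one_div_natCast_mul_log (hs.congr_atTop ?_)
    filter_upwards [eventually_ge_atTop T₁] with T hT
    simp [hg, hT]
  -- termwise `g T ≤ B_T³/T`
  have hle : ∀ T, g T ≤ stripBlim T ^ 3 / T := by
    intro T
    simp only [hg]
    split_ifs with hT
    · have hT2 : 2 ≤ T := le_of_max_le_right hT
      have hTT₀ : T₀ ≤ T := le_of_max_le_left hT
      have hTpos : (0 : ℝ) < T := by exact_mod_cast (show 0 < T by omega)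
      have hlog : 0 < Real.log T := Real.log_pos (by exact_mod_cast hT2)
      have hB := hT₀ T hTT₀
      rw [not_lt] at hB
      have hr0 : 0 ≤ Real.log T ^ (-(1 : ℝ) / 3) := Real.rpow_nonneg hlog.le _
      have hB3 : (Real.log T)⁻¹ ≤ stripBlim T ^ 3 := by
        calc (Real.log T)⁻¹ = (Real.log T ^ (-(1 : ℝ) / 3)) ^ (3 : ℕ) := by
              rw [← Real.rpow_natCast, ← Real.rpow_mul hlog.le]
              norm_num
              rw [Real.rpow_neg_one]
          _ ≤ stripBlim T ^ 3 := pow_le_pow_left₀ hr0 hB 3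
      calc 1 / ((T : ℝ) * Real.log T) = (Real.log T)⁻¹ / T := by
            rw [one_div, mul_inv, mul_comm, div_eq_mul_inv]
        _ ≤ stripBlim T ^ 3 / T := div_le_div_of_nonneg_right hB3 hTpos.le
    · exact stripBlim_pow_three_div_nonneg T
  exact hg_ns (Summable.of_nonneg_of_le hg_nonneg hle summable_stripBlim_cube_div)

end HV

end Literature.Probability.RandomPlanarGeometry.SAW
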